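import Mathlib
import HarnessLib
import Literature.MathematicalPhysics.QuantumLattice.ShiftedHubbardTwoTimeDyson
import Literature.MathematicalPhysics.QuantumLattice.HubbardTwoPointMatsubaraLimit

/-!
# Child `KLRegimeVolumeLimitV12` (stmt-HubbardSuperconductivity-19858), `stub_vl_bound` via (H1): the two remaining GENERIC inputs of the
# assembly wrapper `hasSum_twoPointTime_of_ae_match` — (i) the generic configurations are conull in each marked simplex, (ii) the two-time
# Hubbard Dyson integrand of `hasSum_hubbard_twoPoint_twoTime_renormalised_trace` (k3c5-p1, p484918) is jointly continuous in the times
# (seat hubbard-kl-k3c4-p2, g3; «Matsubara all-U route (R-a)»)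

* **`ae_restrict_simplex_strictMono_Ioo`** — for a.e. `u` in `Δ_k(a) = {w | (∀ i, w i ∈ [0,a]) ∧ Monotone w}`: `StrictMono u` and `u i ∈ (0,a)`
  for all `i` (coincidence hyperplanes and faces are null) — so a pointwise identity proved on GENERIC configurations (all Grassmann time
  differences non-zero) is an a.e. identity on the marked pieces, which is what `hmatch` of `hasSum_twoPointTime_of_ae_match` asks;
* **`continuous_hubbard_twoTime_integrand`** — the density `Φ k j (u, u′)` of p484918 (the `(−β)^{k+j}`-weighted free trace of the two-time word
  `c_{yσ′}·∏ᵢṼ(−βuᵢ)·c†_{xσ}(−(β−s))·∏ₗṼ(−(β−s)−βu′ₗ)`, any finite graph) is continuous on `ℝ^k × ℝ^j` — the hypothesis `hΦc` of the wrapper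
  (finite sums, ordered products and traces of `r ↦ e^{(r·(−β))•dΓ(h)}`-conjugates).

Everything is proved; no definition.
-/

noncomputable section

open scoped Matrix.Norms.L2Operator
open MeasureTheory Finset NormedSpace Literature.MathematicalPhysics.QuantumLattice Literature.Probability.LatticeModels

namespace Summit.HubbardSuperconductivity.HubbardSuperconductivity.Theorems.MatsubaraAllU

set_option linter.dupNamespace false -- summit = problem name (single-conjunct summit), D-0017

/-! ### §1 Generic configurations are conull in the marked simplices -/

/-- **A.e. in the ordered simplex `Δ_k(a)` the coordinates are strictly increasing and lie in the OPEN interval `(0, a)`.** -/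
theorem ae_restrict_simplex_strictMono_Ioo (k : ℕ) (a : ℝ) :
    ∀ᵐ u ∂(volume.restrict {w : Fin k → ℝ | (∀ i, w i ∈ Set.Icc (0 : ℝ) a) ∧ Monotone w}),
      StrictMono u ∧ ∀ i, u i ∈ Set.Ioo (0 : ℝ) a := by
  rw [ae_restrict_iff' (measurableSet_simplex k a)]
  have hcoin : ∀ᵐ u ∂(volume : Measure (Fin k → ℝ)), u ∉ ⋃ i : Fin k, ⋃ j : Fin k, {w : Fin k → ℝ | i ≠ j ∧ w i = w j} :=
    measure_eq_zero_iff_ae_notMem.1 (volume_coincidence_eq_zero k)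
  have hface : ∀ᵐ u ∂(volume : Measure (Fin k → ℝ)), u ∉ {t : Fin k → ℝ | ∃ i, t i = 0 ∨ t i = a} :=
    measure_eq_zero_iff_ae_notMem.1 (volume_setOf_exists_apply_mem_pair (k := k) a)
  filter_upwards [hcoin, hface] with u hu hf hS
  have hinj : Function.Injective u := by
    intro i j hij
    by_contra hne
    exact hu (Set.mem_iUnion.2 ⟨i, Set.mem_iUnion.2 ⟨j, ⟨hne, hij⟩⟩⟩)
  refine ⟨hS.2.strictMono_of_injective hinj, fun i => ?_⟩
  refine ⟨lt_of_le_of_ne (hS.1 i).1 fun h => hf ⟨i, Or.inl h.symm⟩, lt_of_le_of_ne (hS.1 i).2 fun h => hf ⟨i, Or.inr h⟩⟩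

/-! ### §1b Regrouping the two vertex blocks: `Σ_f Σ_{f′} F(f ⧺ f′) = Σ_x F(x)`, and through a site equivalence -/

/-- **The double vertex sum of the two-time Dyson series is one sum over merged configurations**:
`Σ_{f : Fin k → α} Σ_{f′ : Fin j → α} F (f ⧺ f′) = Σ_{x : Fin (k+j) → α} F x` (`Fin.appendEquiv`). -/
theorem sum_sum_append_eq_sum {α M : Type*} [Fintype α] [AddCommMonoid M] {k j : ℕ} (F : (Fin (k + j) → α) → M) :
    ∑ f : Fin k → α, ∑ f' : Fin j → α, F (Fin.append f f') = ∑ x : Fin (k + j) → α, F x := by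
  rw [← Finset.sum_product', Finset.univ_product_univ]
  exact Fintype.sum_equiv (Fin.appendEquiv k j) _ _ (fun p => rfl)

/-- The same with the summand read through an equivalence of the site type (e.g. `FermionTorus.equivTorusSite`):
`Σ_{f, f′ : ⋯ → Λ} F (e ∘ (f ⧺ f′)) = Σ_{x : Fin (k+j) → T} F x` for `e : Λ ≃ T`. -/
theorem sum_sum_append_comp_equiv_eq_sum {Λ T M : Type*} [Fintype Λ] [Fintype T] [AddCommMonoid M] (e : Λ ≃ T) {k j : ℕ}
    (F : (Fin (k + j) → T) → M) :
    ∑ f : Fin k → Λ, ∑ f' : Fin j → Λ, F (fun a => e (Fin.append f f' a)) = ∑ x : Fin (k + j) → T, F x := by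
  rw [sum_sum_append_eq_sum (fun y : Fin (k + j) → Λ => F (fun a => e (y a)))]
  exact Fintype.sum_equiv ((Equiv.refl (Fin (k + j))).arrowCongr e) _ _ (fun y => congrArg F (funext fun a => by
    simp [Equiv.arrowCongr_apply]))

/-! ### §2 Continuity of the two-time Hubbard Dyson integrand -/

section Continuity

variable {Λ : Type*} [LinearOrder Λ] [Fintype Λ] (G : SimpleGraph Λ) [DecidableRel G.Adj]

/-- An evolved one-body letter `r ↦ e^{(c(r)·(−β))•H} A e^{−(c(r)·(−β))•H}` is continuous in the parameter when `c` is. -/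
private theorem continuous_evolved {X : Type*} [TopologicalSpace X] (β : ℝ) (H A : Matrix (Finset (Orb Λ)) (Finset (Orb Λ)) ℂ)
    {c : X → ℝ} (hc : Continuous c) :
    Continuous fun p : X => exp ((((c p : ℝ) : ℂ) * -(β : ℂ)) • H) * A * exp (-((((c p : ℝ) : ℂ) * -(β : ℂ)) • H)) := by
  letI : NormedAlgebra ℚ (Matrix (Finset (Orb Λ)) (Finset (Orb Λ)) ℂ) := .restrictScalars ℚ ℂ _
  have hs : Continuous fun p : X => (((c p : ℝ) : ℂ) * -(β : ℂ)) • H :=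
    ((Complex.continuous_ofReal.comp hc).mul continuous_const).smul continuous_const
  exact ((exp_continuous.comp hs).mul continuous_const).mul (exp_continuous.comp hs.neg)

/-- **The two-time Hubbard Dyson integrand is jointly continuous in the times** (hypothesis `hΦc` of `hasSum_twoPointTime_of_ae_match` for
the densities of k3c5-p1's `hasSum_hubbard_twoPoint_twoTime_renormalised_trace`; any finite graph, every `β, t, U, μ, ν, s`). -/
theorem continuous_hubbard_twoTime_integrand (β t μ ν : ℝ) (x y : Λ) (σ σ' : Fin 2) (s : ℝ) (k j : ℕ) :
    Continuous (Function.uncurry fun (u : Fin k → ℝ) (u' : Fin j → ℝ) =>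
            (-(β : ℂ)) ^ (k + j) * ∑ f : Fin k → Λ, ∑ f' : Fin j → Λ,
              (Matrix.gibbsWeight β (dGamma (hubbardOneBody G t μ)) * (annihilation (orb y σ') *
                ((List.ofFn fun i : Fin k =>
                    ((exp ((((u i : ℝ) : ℂ) * -(β : ℂ)) • dGamma (hubbardOneBody G t μ)) * creation (orb (f i) 0) *
                          exp (-((((u i : ℝ) : ℂ) * -(β : ℂ)) • dGamma (hubbardOneBody G t μ)))) *
                        (exp ((((u i : ℝ) : ℂ) * -(β : ℂ)) • dGamma (hubbardOneBody G t μ)) * annihilation (orb (f i) 0) *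
                          exp (-((((u i : ℝ) : ℂ) * -(β : ℂ)) • dGamma (hubbardOneBody G t μ)))) -
                      (ν : ℂ) • (1 : Matrix (Finset (Orb Λ)) (Finset (Orb Λ)) ℂ)) *
                    ((exp ((((u i : ℝ) : ℂ) * -(β : ℂ)) • dGamma (hubbardOneBody G t μ)) * creation (orb (f i) 1) *
                          exp (-((((u i : ℝ) : ℂ) * -(β : ℂ)) • dGamma (hubbardOneBody G t μ)))) *
                        (exp ((((u i : ℝ) : ℂ) * -(β : ℂ)) • dGamma (hubbardOneBody G t μ)) * annihilation (orb (f i) 1) *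
                          exp (-((((u i : ℝ) : ℂ) * -(β : ℂ)) • dGamma (hubbardOneBody G t μ)))) -
                      (ν : ℂ) • (1 : Matrix (Finset (Orb Λ)) (Finset (Orb Λ)) ℂ))).prod *
                  (exp (((((β - s) / β : ℝ) : ℂ) * -(β : ℂ)) • dGamma (hubbardOneBody G t μ)) * creation (orb x σ) *
                    exp (-(((((β - s) / β : ℝ) : ℂ) * -(β : ℂ)) • dGamma (hubbardOneBody G t μ)))) *
                  (List.ofFn fun l : Fin j =>
                    ((exp ((((((β - s) / β + u' l : ℝ) : ℂ)) * -(β : ℂ)) • dGamma (hubbardOneBody G t μ)) * creation (orb (f' l) 0) *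
                          exp (-((((((β - s) / β + u' l : ℝ) : ℂ)) * -(β : ℂ)) • dGamma (hubbardOneBody G t μ)))) *
                        (exp ((((((β - s) / β + u' l : ℝ) : ℂ)) * -(β : ℂ)) • dGamma (hubbardOneBody G t μ)) *
                            annihilation (orb (f' l) 0) *
                          exp (-((((((β - s) / β + u' l : ℝ) : ℂ)) * -(β : ℂ)) • dGamma (hubbardOneBody G t μ)))) -
                      (ν : ℂ) • (1 : Matrix (Finset (Orb Λ)) (Finset (Orb Λ)) ℂ)) *
                    ((exp ((((((β - s) / β + u' l : ℝ) : ℂ)) * -(β : ℂ)) • dGamma (hubbardOneBody G t μ)) * creation (orb (f' l) 1) *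
                          exp (-((((((β - s) / β + u' l : ℝ) : ℂ)) * -(β : ℂ)) • dGamma (hubbardOneBody G t μ)))) *
                        (exp ((((((β - s) / β + u' l : ℝ) : ℂ)) * -(β : ℂ)) • dGamma (hubbardOneBody G t μ)) *
                            annihilation (orb (f' l) 1) *
                          exp (-((((((β - s) / β + u' l : ℝ) : ℂ)) * -(β : ℂ)) • dGamma (hubbardOneBody G t μ)))) -
                      (ν : ℂ) • (1 : Matrix (Finset (Orb Λ)) (Finset (Orb Λ)) ℂ))).prod))).trace) := by
  letI : NormedAlgebra ℚ (Matrix (Finset (Orb Λ)) (Finset (Orb Λ)) ℂ) := .restrictScalars ℚ ℂ _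
  -- the trace is a continuous linear functional
  set Ltr : Matrix (Finset (Orb Λ)) (Finset (Orb Λ)) ℂ →L[ℂ] ℂ :=
    LinearMap.toContinuousLinearMap (Matrix.traceLinearMap (Finset (Orb Λ)) ℂ ℂ) with hLtr
  have hLtr_apply : ∀ M : Matrix (Finset (Orb Λ)) (Finset (Orb Λ)) ℂ, Ltr M = M.trace := fun M => rfl
  simp only [Function.uncurry_def]
  refine Continuous.mul continuous_const (continuous_finsetSum _ fun f _ => continuous_finsetSum _ fun f' _ => ?_)
  simp_rw [← hLtr_apply]
  refine Ltr.continuous.comp ?_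
  refine Continuous.mul continuous_const ?_
  refine Continuous.mul continuous_const (Continuous.mul (Continuous.mul ?_ continuous_const) ?_)
  · -- the first block: an ordered product of continuous letters in `u`
    simp_rw [List.ofFn_eq_map]
    refine continuous_list_prod _ fun i _ => ?_
    have hc : Continuous fun p : (Fin k → ℝ) × (Fin j → ℝ) => p.1 i := (continuous_apply i).comp continuous_fst
    exact (((continuous_evolved (Λ := Λ) β _ _ hc).mul (continuous_evolved (Λ := Λ) β _ _ hc)).sub continuous_const).mul
      (((continuous_evolved (Λ := Λ) β _ _ hc).mul (continuous_evolved (Λ := Λ) β _ _ hc)).sub continuous_const)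
  · -- the second block: letters in `u'`
    simp_rw [List.ofFn_eq_map]
    refine continuous_list_prod _ fun l _ => ?_
    have hc : Continuous fun p : (Fin k → ℝ) × (Fin j → ℝ) => (β - s) / β + p.2 l :=
      continuous_const.add ((continuous_apply l).comp continuous_snd)
    exact (((continuous_evolved (Λ := Λ) β _ _ hc).mul (continuous_evolved (Λ := Λ) β _ _ hc)).sub continuous_const).mul
      (((continuous_evolved (Λ := Λ) β _ _ hc).mul (continuous_evolved (Λ := Λ) β _ _ hc)).sub continuous_const)

end Continuity

end Summit.HubbardSuperconductivity.HubbardSuperconductivity.Theorems.MatsubaraAllU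

end
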